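import Summits.FinalStateConjecture.FinalStateConjecture.Theses.KerrnessPropagates
import Summits.FinalStateConjecture.FinalStateConjecture.Theorems.SwallowTheDatumMGHDExists
import Summits.FinalStateConjecture.FinalStateConjecture.Theorems.SwallowTheDatumMGHDExistsInputs
import Literature.Geometry.Lorentzian.AdmissibleMGHDExistence
import Summits.FinalStateConjecture.FinalStateConjecture.Theorems.SwallowTheDatumSubdataDevelopmentsEmbedLocalisationLocallyUnique
import Literature.Geometry.Lorentzian.CommonDevelopmentProperExtension

/-!
# Route KerrnessPropagates · item `MaximalDevelopmentExists` (stmt-FinalStateConjecture-9927)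

The route decl
`Summit.FinalStateConjecture.FinalStateConjecture.Theses.KerrnessPropagates.MaximalDevelopmentExists`
(support, rank 9; the anti-vacuity conjunct of the Statement, a hypothesis of the route's deciding
theorem `KerrnessPropagates.closes`) reads: for every connected, Hausdorff, second countable smooth
`3`-manifold `X` and every Christodoulou-admissible vacuum datum `D ∈ admissibleVacuumData X` there
is a maximal vacuum Cauchy development `𝒟 : VacuumCauchyDevelopment D`, `𝒟.IsMaximal`
(Choquet-Bruhat–Geroch, Comm. Math. Phys. 14 (1969), Thm. 3, p. 332; Sbierski, Ann. Henri Poincaré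
17 (2016), Thm. 2.8; Ringström 2009, Thm. 16.6).

As a proposition it is, verbatim, the tree's named fact
`Literature.Geometry.Lorentzian.choquetBruhat_geroch_exists_mghd_cauchy`
(`CauchyProblemMGHDExistence.lean`) restricted to the admissible class, and it is the SAME term as
the sibling routes' items `SwallowTheDatum.MGHDExists` (stmt-FinalStateConjecture-9937),
`ConcentrationCannotWait.MaximalDevelopmentExists`, `KerrBurial.MGHDExistence`, … . The named fact is
undischarged: what it still owes is the local existence and local geometric uniqueness theory of
the vacuum Einstein equations in wave gauge (Choquet-Bruhat 1952; Sbierski 2016, Thm. 4) and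
Sbierski's Theorem 12, none of which has a carrier in Mathlib at the pin; the order-theoretic frame
(Zorn), the union of chains and the gluing along the maximal common development are already
theorems of the tree (`CauchyProblemMGHDExistenceProofs`, `ChainUnionDevelopment`,
`DevelopmentGluing*`, `MGHDExistenceReduction`). Accordingly this file lands, sorry-free:

* `maximalDevelopmentExists_of_choquetBruhatGeroch` — the CONDITIONAL closure of the item from the
  named fact (trust base: Choquet-Bruhat–Geroch 1969, Thm. 3);
* `maximalDevelopmentExists_iff_mghdExists` — the item is, definitionally, the sibling item
  `SwallowTheDatum.MGHDExists` (so either item's closure closes the other by one line, and every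
  reduction landed for stmt-9937 transports verbatim);
* `maximalDevelopmentExists_of_localExistence_of_localTheory_of_notMCGHD` — the item from the
  three displayed inputs of the printed proofs restricted to admissible data (local existence;
  Sbierski 2016, Thm. 4; Sbierski 2016, Thm. 12), transported from
  `Theorems.mghdExists_of_localExistence_of_localTheory_of_notMCGHD`: exactly what an unconditional
  proof still owes;
* `maximalDevelopmentExists_of_localExistence` (appended) — the same with inputs (2) and (3)
  supplied by the tree's REGISTERED named facts `hawkingEllis_locallyUnique_vacuumDevelopment`
  (`CauchyProblemLocalUniqueness.lean`; Hawking–Ellis 1973, §7.5, Sbierski 2016, Thm. 2.4 (ii)) and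
  `sbierski_commonDevelopment_lt_of_hasCorrespondingBoundaryPoints`
  (`CommonDevelopmentProperExtension.lean`; Sbierski 2016, Thm. 12): modulo those two facts the item
  is LOCAL EXISTENCE on the admissible class and nothing else.

No definition is introduced; nothing is restated; no named fact is added.
-/

noncomputable section

open scoped Manifold ContDiff
open TopologicalSpace

-- `Summit.FinalStateConjecture.FinalStateConjecture.…`: summit = sub-problem name (D-0017), as in every file here
set_option linter.dupNamespace false

namespace Summit.FinalStateConjecture.FinalStateConjecture.Theorems.KerrnessPropagates

open Literature.Geometry.Lorentzian

/-- **Conditional closure of item `MaximalDevelopmentExists` (stmt-FinalStateConjecture-9927).**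
Under the named fact `choquetBruhat_geroch_exists_mghd_cauchy` (Choquet-Bruhat–Geroch 1969,
Thm. 3: every smooth solution of the vacuum constraints on a connected Hausdorff second countable
`3`-manifold has a maximal vacuum Cauchy development), every admissible vacuum datum has a maximal
vacuum Cauchy development — the route decl `KerrnessPropagates.MaximalDevelopmentExists`. One line
over the tree corollary
`choquetBruhat_geroch_exists_mghd_cauchy.exists_isMaximal_of_mem_admissibleVacuumData` (which
supplies the Levi-Civita instance by `PseudoRiemannianMetric.hasLeviCivita` and the constraint
hypothesis by `isVacuumConstraintSolution_of_mem_admissibleVacuumData`). CONDITIONAL: trust base =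
the undischarged fact. -/
theorem maximalDevelopmentExists_of_choquetBruhatGeroch
    (h : choquetBruhat_geroch_exists_mghd_cauchy) :
    Summit.FinalStateConjecture.FinalStateConjecture.Theses.KerrnessPropagates.MaximalDevelopmentExists := by
  unfold Theses.KerrnessPropagates.MaximalDevelopmentExists
  intro X _ _ _ _ _ _ D hD
  exact h.exists_isMaximal_of_mem_admissibleVacuumData hD

/-- **The item is the sibling item.** `KerrnessPropagates.MaximalDevelopmentExists`
(stmt-FinalStateConjecture-9927) and `SwallowTheDatum.MGHDExists` (stmt-FinalStateConjecture-9937)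
are the same proposition (`∀ D, D ∈ S → P` and `∀ D ∈ S, P`, `𝓘(ℝ, E3)` and `𝓡 3` elaborate to
the same terms): the equivalence is `Iff.rfl`. [folklore] -/
theorem maximalDevelopmentExists_iff_mghdExists :
    Summit.FinalStateConjecture.FinalStateConjecture.Theses.KerrnessPropagates.MaximalDevelopmentExists ↔
      Summit.FinalStateConjecture.FinalStateConjecture.Theses.SwallowTheDatum.MGHDExists :=
  Iff.rfl

/-- **Item `MaximalDevelopmentExists` from "local existence", "local theory" (Sbierski 2016,
Thm. 4) and "NotMCGHD" (Sbierski 2016, Thm. 12), all restricted to admissible data** — the finest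
reduction of the item the tree's vocabulary currently expresses, transported along
`maximalDevelopmentExists_iff_mghdExists` from
`Theorems.mghdExists_of_localExistence_of_localTheory_of_notMCGHD` (Zorn frame, union of chains
`ChainUnionDevelopment`, gluing along the maximal common globally hyperbolic development). Inputs:
(1) some vacuum Cauchy development of each admissible datum exists (Choquet-Bruhat 1952 local
existence, globalised); (2) any two vacuum Cauchy developments of an admissible datum have a common
globally hyperbolic development (local geometric uniqueness); (3) a common development with
corresponding boundary points is strictly contained in a larger one (Sbierski 2016, Thm. 12). -/
theorem maximalDevelopmentExists_of_localExistence_of_localTheory_of_notMCGHD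
    (hex : ∀ (X : Type) [TopologicalSpace X] [ChartedSpace E3 X] [IsManifold (𝓡 3) ∞ X]
      [T2Space X] [SecondCountableTopology X] [ConnectedSpace X] (D : InitialDataSet (𝓡 3) X),
      D ∈ admissibleVacuumData X → Nonempty (VacuumCauchyDevelopment D))
    (hlocal : ∀ (X : Type) [TopologicalSpace X] [ChartedSpace E3 X] [IsManifold (𝓡 3) ∞ X]
      [T2Space X] [SecondCountableTopology X] [ConnectedSpace X] (D : InitialDataSet (𝓡 3) X),
      D ∈ admissibleVacuumData X → ∀ 𝒟 𝒟' : VacuumCauchyDevelopment D,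
        ∃ U : Opens 𝒟.carrier, 𝒟.toCauchyDevelopment.IsCommonDevelopment 𝒟'.toDataEmbedding U)
    (h12 : ∀ (X : Type) [TopologicalSpace X] [ChartedSpace E3 X] [IsManifold (𝓡 3) ∞ X]
      [T2Space X] [SecondCountableTopology X] [ConnectedSpace X] (D : InitialDataSet (𝓡 3) X),
      D ∈ admissibleVacuumData X → ∀ (𝒟 𝒟' : VacuumCauchyDevelopment D)
        (𝔠 : CauchyDevelopment.CommonDevelopment 𝒟.toCauchyDevelopment 𝒟'.toCauchyDevelopment),
        𝔠.HasCorrespondingBoundaryPoints →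
          ∃ V : Opens 𝒟.carrier,
            𝒟.toCauchyDevelopment.IsCommonDevelopment 𝒟'.toDataEmbedding V ∧ 𝔠.opens < V) :
    Summit.FinalStateConjecture.FinalStateConjecture.Theses.KerrnessPropagates.MaximalDevelopmentExists :=
  maximalDevelopmentExists_iff_mghdExists.mpr
    (Theorems.mghdExists_of_localExistence_of_localTheory_of_notMCGHD hex hlocal h12)

/-- **Item `MaximalDevelopmentExists` from local existence on the admissible class, modulo the two
REGISTERED named facts of the local theory.** The inputs (2) and (3) of
`maximalDevelopmentExists_of_localExistence_of_localTheory_of_notMCGHD` are supplied by the tree's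
named facts `hawkingEllis_locallyUnique_vacuumDevelopment` (Hawking–Ellis 1973, §7.5; Sbierski
2016, Thm. 2.4 (ii): any two vacuum Cauchy developments of a datum are extensions of a common one —
in its realised shape, `SubdataDevelopmentsEmbed.exists_isCommonDevelopment_of_locallyUnique`) and
`sbierski_commonDevelopment_lt_of_hasCorrespondingBoundaryPoints` (Sbierski 2016, Thm. 12: a common
globally hyperbolic development with corresponding boundary points is strictly contained in a
larger one). What then remains displayed is exactly LOCAL EXISTENCE: every admissible datum has
some vacuum Cauchy development (Fourès-Bruhat 1952; Choquet-Bruhat–Geroch 1969, Thm. 1, p. 331;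
Ringström 2009, Thm. 14.2) — the hyperbolic PDE theory of the vacuum Einstein equations in wave
gauge, absent from Mathlib at the pin. CONDITIONAL: trust base = the two undischarged facts.
[cite: ChoquetBruhatGeroch1969CMP, Thm. 1 (p. 331) and Thm. 3 (p. 332)]
[cite: Sbierski2016AHP, Thm. 2.4 (ii), Thm. 12 and Thm. 2.8] -/
theorem maximalDevelopmentExists_of_localExistence
    (hex : ∀ (X : Type) [TopologicalSpace X] [ChartedSpace E3 X] [IsManifold (𝓡 3) ∞ X]
      [T2Space X] [SecondCountableTopology X] [ConnectedSpace X] (D : InitialDataSet (𝓡 3) X),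
      D ∈ admissibleVacuumData X → Nonempty (VacuumCauchyDevelopment D))
    (hlu : hawkingEllis_locallyUnique_vacuumDevelopment)
    (h12 : sbierski_commonDevelopment_lt_of_hasCorrespondingBoundaryPoints) :
    Summit.FinalStateConjecture.FinalStateConjecture.Theses.KerrnessPropagates.MaximalDevelopmentExists :=
  maximalDevelopmentExists_of_localExistence_of_localTheory_of_notMCGHD hex
    (fun X _ _ _ _ _ _ D _ 𝒟 𝒟' ↦
      SubdataDevelopmentsEmbed.exists_isCommonDevelopment_of_locallyUnique hlu X D 𝒟 𝒟')
    (fun X _ _ _ _ _ _ D _ ↦ h12 X D)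

end Summit.FinalStateConjecture.FinalStateConjecture.Theorems.KerrnessPropagates

end
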